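import Literature.AlgebraicGeometry.Morphisms.ClopenPieceOfCoproduct
import Literature.AlgebraicGeometry.CossartPiltant200819.Thm21ProjectiveMorphisms2008
import Literature.NumberTheory.Transcendental.Analytification
import Mathlib.CategoryTheory.Limits.Constructions.FiniteProductsOfBinaryProducts
import Mathlib.AlgebraicGeometry.Morphisms.Smooth
import HarnessLib

/-!
# Finite coproducts of `k`-schemes: projectivity, smoothness and rational points of the apex of a colimit cofan

Topic `AlgebraicGeometry/Motives`; namespace `Literature.AlgebraicGeometry.Motives`.  THEOREMS ONLY (no definition,
no named fact).  For a FINITE family `X : σ → SchemeOver k` of schemes over a field `k` and a colimit cofan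
`(f i : X i ⟶ S)_{i ∈ σ}` in `SchemeOver k` (so `S ≅ ∐ X i` as `k`-schemes, the legs being open immersions with
pairwise disjoint covering images — the tree's `Morphisms/ClopenPieceOfCoproduct`):

* `isProjectiveOver_coprodMk` — the disjoint union `X ⨿ Y` of two projective `k`-schemes (apex
  `Over.mk (coprod.desc X.hom Y.hom)`) is projective over `k` (two closed immersions into `ℙᵃ_k`, `ℙᵇ_k`
  followed by the disjoint linear embeddings `ℙᵃ, ℙᵇ ↪ ℙᵃ⁺ᵇ⁺¹`; the tree's
  `CP2008.IsProjectiveOver.coprodDesc`, Hartshorne II §4 and Ex. 3.12);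
* `isProjectiveOver_of_isColimit_cofan` — the apex `S` of a finite colimit cofan of projective `k`-schemes is
  projective (induction on the number of summands through Mathlib's `extendCofan`);
* `smoothOfRelativeDimension_of_isColimit_cofan` — if every `X i → Spec k` is smooth of relative dimension `d`
  then so is `S → Spec k` (smoothness is Zariski-local at the source);
* `exists_sigmaHomeomorph_of_isColimit_cofan` — for a topological field `L` over `k`, the `L`-points of `S`
  with their strong topology are the topological disjoint union of the `L`-points of the summands:
  `(Σ i, X i (L)) ≃ₜ S(L)`, `⟨i, P⟩ ↦ f i ∘ P` (each `f i` induces an open embedding on `L`-points, the tree's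
  `AlgPoints.isOpenEmbedding_map_holds`, SGA1 XII Prop. 3.1 (xi); the images partition `S(L)`).

Use (cells pub-hodgecm / pub-hodgecm2): assembling the COMPLEX MODEL `∐_q X_q` of a compact unitary Shimura
surface from its pieces (`ShimuraVarieties/UnitaryShimuraComplexModel`).

## References
* [Hartshorne1977] R. Hartshorne, *Algebraic Geometry*, GTM 52 (1977), II §4 (projective morphisms, p. 103),
  II Ex. 3.12, III Prop. 10.1.
* [GortzWedhorn2020] U. Görtz, T. Wedhorn, *Algebraic Geometry I* (2nd ed. 2020), §(3.5) Example 3.11 (disjoint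
  unions of schemes).
* [SGA1] A. Grothendieck, M. Raynaud, *SGA 1*, Exp. XII, Prop. 3.1 (xi).
-/

set_option autoImplicit false

noncomputable section

open CategoryTheory CategoryTheory.Limits AlgebraicGeometry Set Function
open _root_.Topology

namespace Literature.AlgebraicGeometry.Motives

universe u

variable {k : Type u} [Field k]

/-! ### §1. Projectivity over `k` in Hartshorne's relative form over the base `Spec k` -/

/-- A projective `k`-scheme `X` has projective structure morphism in the relative sense of Hartshorne II §4
(a closed immersion into `ℙᵐ_k ×_k Spec k` over `Spec k`; the tree's `CP2008.IsProjectiveOver (𝟙 (Spec k)) X.hom`).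
[cite: Hartshorne1977, II §4 Definition p. 103] -/
theorem cp2008_isProjectiveOver_hom {X : SchemeOver k} (hX : IsProjectiveOver X) :
    CossartPiltant200819.CP2008.IsProjectiveOver (𝟙 (Spec (.of k))) X.hom := by
  obtain ⟨m, e, he⟩ := hX
  haveI : IsClosedImmersion e.left := he
  have hw : e.left ≫ (projectiveSpace m k).hom = X.hom ≫ 𝟙 (Spec (.of k)) := by
    rw [Category.comp_id]; exact Over.w e
  let i : X.left ⟶ pullback (projectiveSpace m k).hom (𝟙 (Spec (.of k))) :=
    pullback.lift e.left X.hom hw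
  have hi : i ≫ pullback.fst _ _ = e.left := pullback.lift_fst _ _ _
  haveI : IsClosedImmersion (i ≫ pullback.fst (projectiveSpace m k).hom (𝟙 (Spec (.of k)))) := by
    rw [hi]; infer_instance
  exact ⟨m, i, IsClosedImmersion.of_comp i (pullback.fst (projectiveSpace m k).hom (𝟙 (Spec (.of k)))),
    pullback.lift_snd _ _ _⟩

/-- Conversely, a morphism `ρ : Z → Spec k` projective in the relative sense of Hartshorne II §4 over `Spec k`
makes `Z` a projective `k`-scheme (compose the closed immersion `Z ↪ ℙᵐ_k ×_k Spec k` with the first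
projection, an isomorphism). [cite: Hartshorne1977, II §4 Definition p. 103] -/
theorem isProjectiveOver_mk_of_cp2008 {Z : Scheme.{u}} {ρ : Z ⟶ Spec (.of k)}
    (h : CossartPiltant200819.CP2008.IsProjectiveOver (𝟙 (Spec (.of k))) ρ) :
    IsProjectiveOver (Over.mk ρ : SchemeOver k) := by
  obtain ⟨m, i, hi, hiρ⟩ := h
  haveI := hi
  have hw : (i ≫ pullback.fst (projectiveSpace m k).hom (𝟙 (Spec (.of k)))) ≫ (projectiveSpace m k).hom =
      (Over.mk ρ : SchemeOver k).hom := by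
    change (i ≫ pullback.fst _ _) ≫ _ = ρ
    rw [Category.assoc, pullback.condition, ← Category.assoc, hiρ, Category.comp_id]
  exact ⟨m, Over.homMk (i ≫ pullback.fst (projectiveSpace m k).hom (𝟙 (Spec (.of k)))) hw,
    inferInstanceAs (IsClosedImmersion (i ≫ pullback.fst (projectiveSpace m k).hom (𝟙 (Spec (.of k)))))⟩

/-! ### §2. The disjoint union of two `k`-schemes -/

section Binary

variable (X Y : SchemeOver k)

/-- **The binary coproduct in `SchemeOver k`, explicitly**: the scheme `X ⨿ Y` with structure morphism
`coprod.desc X.hom Y.hom` and legs `coprod.inl`, `coprod.inr` is a colimit binary cofan of `k`-schemes (the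
forgetful functor `Over (Spec k) → Scheme` reflects colimits; Görtz–Wedhorn I Example 3.11).
[cite: GortzWedhorn2020, §(3.5) Example 3.11 (p. 73)] -/
theorem nonempty_isColimit_binaryCofan_coprod :
    Nonempty (IsColimit (BinaryCofan.mk
      (Over.homMk coprod.inl (coprod.inl_desc X.hom Y.hom) :
        X ⟶ (Over.mk (coprod.desc X.hom Y.hom) : SchemeOver k))
      (Over.homMk coprod.inr (coprod.inr_desc X.hom Y.hom) :
        Y ⟶ (Over.mk (coprod.desc X.hom Y.hom) : SchemeOver k)))) :=
  ⟨isColimitOfReflectsOfMapIsColimit (Over.forget (Spec (.of k))) _ _ (coprodIsCoprod X.left Y.left)⟩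

/-- **The disjoint union of two projective `k`-schemes is projective** (closed immersions `X ↪ ℙᵃ_k`,
`Y ↪ ℙᵇ_k` followed by the disjoint linear subspaces `ℙᵃ, ℙᵇ ⊂ ℙᵃ⁺ᵇ⁺¹`; the tree's
`CP2008.IsProjectiveOver.coprodDesc`). [cite: Hartshorne1977, II §4 p. 103; II Ex. 3.12] -/
theorem isProjectiveOver_coprodMk (hX : IsProjectiveOver X) (hY : IsProjectiveOver Y) :
    IsProjectiveOver (Over.mk (coprod.desc X.hom Y.hom) : SchemeOver k) :=
  isProjectiveOver_mk_of_cp2008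
    (CossartPiltant200819.CP2008.IsProjectiveOver.coprodDesc (cp2008_isProjectiveOver_hom hX)
      (cp2008_isProjectiveOver_hom hY))

end Binary

/-! ### §3. The apex of a finite colimit cofan -/

section Cofan

/-- `IsProjectiveOver` is invariant under isomorphisms of `k`-schemes. [folklore] -/
private theorem isProjectiveOver_of_overIso {S S' : SchemeOver k} (e : S ≅ S') (h : IsProjectiveOver S') :
    IsProjectiveOver S := by
  obtain ⟨n, κ, hκ⟩ := h
  haveI := hκ
  exact ⟨n, e.hom ≫ κ, inferInstanceAs (IsClosedImmersion (e.hom.left ≫ κ.left))⟩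

/-- The apex of a colimit cofan over the EMPTY index `Fin 0` is the empty scheme, hence projective (the empty
scheme is a closed subscheme of `ℙ⁰_k`). [cite: Hartshorne1977, II §4 p. 103] -/
theorem isProjectiveOver_of_isColimit_cofan_fin_zero (X : Fin 0 → SchemeOver k) (S : SchemeOver k)
    (f : ∀ i, X i ⟶ S) (hc : IsColimit (Cofan.mk S f)) : IsProjectiveOver S := by
  obtain ⟨hc'⟩ := Morphisms.isColimit_cofan_left hc
  haveI : IsEmpty S.left := ⟨fun s => by
    obtain ⟨i, -, -⟩ := Morphisms.exists_eq_of_isColimit_cofan hc' s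
    exact i.elim0⟩
  let e : S.left ⟶ (projectiveSpace 0 k).left := (isInitialOfIsEmpty (X := S.left)).to _
  have hw : e ≫ (projectiveSpace 0 k).hom = S.hom := (isInitialOfIsEmpty (X := S.left)).hom_ext _ _
  exact ⟨0, Over.homMk e hw, inferInstanceAs (IsClosedImmersion e)⟩

/-- **The apex of a colimit cofan of finitely many projective `k`-schemes, indexed by `Fin n`, is projective**
(induction on `n`: `∐_{i < n+1} X i ≅ X 0 ⨿ ∐_{i < n} X (i+1)`, Mathlib `extendCofanIsColimit`, and §2).
[cite: Hartshorne1977, II §4 p. 103; II Ex. 3.12] [cite: GortzWedhorn2020, §(3.5) Example 3.11 (p. 73)] -/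
theorem isProjectiveOver_of_isColimit_cofan_fin :
    ∀ (n : ℕ) (X : Fin n → SchemeOver k) (S : SchemeOver k) (f : ∀ i, X i ⟶ S),
      IsColimit (Cofan.mk S f) → (∀ i, IsProjectiveOver (X i)) → IsProjectiveOver S := by
  intro n
  induction n with
  | zero => exact fun X S f hc _ => isProjectiveOver_of_isColimit_cofan_fin_zero X S f hc
  | succ n ih =>
    intro X S f hc hX
    -- the coproduct of the last `n` summands, in `SchemeOver k`
    let c₁ : Cofan fun i : Fin n => X i.succ := Cofan.mk (∐ fun i : Fin n => X i.succ) (Sigma.ι _)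
    have t₁ : IsColimit c₁ := coproductIsCoproduct _
    have h₁ : IsProjectiveOver c₁.pt := ih (fun i => X i.succ) c₁.pt (Sigma.ι _) t₁ fun i => hX i.succ
    -- the binary coproduct `X 0 ⨿ c₁.pt`, explicitly
    let B : SchemeOver k := Over.mk (coprod.desc (X 0).hom c₁.pt.hom)
    let c₂ : BinaryCofan (X 0) c₁.pt := BinaryCofan.mk
      (Over.homMk coprod.inl (coprod.inl_desc (X 0).hom c₁.pt.hom) : X 0 ⟶ B)
      (Over.homMk coprod.inr (coprod.inr_desc (X 0).hom c₁.pt.hom) : c₁.pt ⟶ B)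
    obtain ⟨t₂⟩ : Nonempty (IsColimit c₂) := nonempty_isColimit_binaryCofan_coprod (X 0) c₁.pt
    have hB : IsProjectiveOver B := isProjectiveOver_coprodMk (X 0) c₁.pt (hX 0) h₁
    -- `S ≅ X 0 ⨿ c₁.pt` by uniqueness of colimits
    have t : IsColimit (extendCofan c₁ c₂) := extendCofanIsColimit X t₁ t₂
    exact isProjectiveOver_of_overIso (hc.coconePointUniqueUpToIso t) hB

variable {σ : Type} [Finite σ] {X : σ → SchemeOver k} {S : SchemeOver k} {f : ∀ i, X i ⟶ S}

omit [Finite σ] in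
/-- Re-indexing a colimit cofan along an equivalence of index types. [folklore] -/
private theorem nonempty_isColimit_cofan_reindex {σ' : Type} (e : σ' ≃ σ) (hc : IsColimit (Cofan.mk S f)) :
    Nonempty (IsColimit (Cofan.mk S (fun j => f (e j)) : Cofan fun j => X (e j))) := by
  let E := Discrete.equivalence e
  have h1 : IsColimit ((Cofan.mk S f).whisker E.functor) := IsColimit.whiskerEquivalence hc E
  let φ : (E.functor ⋙ Discrete.functor X) ≅ Discrete.functor (fun j => X (e j)) :=
    Discrete.natIso fun _ => Iso.refl _
  have h2 : IsColimit ((Cocone.precompose φ.inv).obj ((Cofan.mk S f).whisker E.functor)) :=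
    (IsColimit.precomposeInvEquiv φ _).symm h1
  refine ⟨IsColimit.ofIsoColimit h2 (Cocone.ext (Iso.refl _) ?_)⟩
  rintro ⟨j⟩
  change 𝟙 _ ≫ f (e j) ≫ 𝟙 S = f (e j)
  rw [Category.id_comp, Category.comp_id]

/-- **The apex of a colimit cofan of finitely many projective `k`-schemes is projective** (disjoint unions
of finitely many projective schemes are projective). [cite: Hartshorne1977, II §4 p. 103; II Ex. 3.12]
[cite: GortzWedhorn2020, §(3.5) Example 3.11 (p. 73)] -/
theorem isProjectiveOver_of_isColimit_cofan (hc : IsColimit (Cofan.mk S f))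
    (hX : ∀ i, IsProjectiveOver (X i)) : IsProjectiveOver S := by
  obtain ⟨n, ⟨e⟩⟩ := Finite.exists_equiv_fin σ
  obtain ⟨hc'⟩ := nonempty_isColimit_cofan_reindex e.symm hc
  exact isProjectiveOver_of_isColimit_cofan_fin n (fun j => X (e.symm j)) S (fun j => f (e.symm j)) hc'
    fun j => hX _

omit [Finite σ] in
/-- **The apex of a colimit cofan of `k`-schemes smooth of relative dimension `d` is smooth of relative
dimension `d`** (the legs are open immersions covering the apex, and smoothness of a given relative dimension
is Zariski-local at the source). [cite: Hartshorne1977, III Prop. 10.1] -/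
theorem smoothOfRelativeDimension_of_isColimit_cofan {d : ℕ} (hc : IsColimit (Cofan.mk S f))
    (hX : ∀ i, SmoothOfRelativeDimension d (X i).hom) : SmoothOfRelativeDimension d S.hom := by
  obtain ⟨hc'⟩ := Morphisms.isColimit_cofan_left hc
  haveI : ∀ i, IsOpenImmersion (f i).left := Morphisms.isOpenImmersion_of_isColimit_cofan hc'
  let 𝒰 : S.left.OpenCover := Scheme.Cover.mkOfCovers σ (fun i => (X i).left) (fun i => (f i).left)
    (fun s => Morphisms.exists_eq_of_isColimit_cofan hc' s)
  refine IsZariskiLocalAtSource.of_openCover (P := @SmoothOfRelativeDimension d) 𝒰 fun i => ?_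
  change SmoothOfRelativeDimension d ((f i).left ≫ S.hom)
  rw [Over.w (f i)]
  exact hX i

end Cofan

/-! ### §4. Rational points of the apex: the topological disjoint union of the points of the summands -/

section Points

variable {σ : Type} {X : σ → SchemeOver k} {S : SchemeOver k} {f : ∀ i, X i ⟶ S}
  (L : Type u) [Field L] [Algebra k L] [TopologicalSpace L]

/-- **The `L`-points of the apex of a colimit cofan are the topological disjoint union of the `L`-points of the
summands**: for a colimit cofan `(f i : X i ⟶ S)` in `SchemeOver k` and a topological field `L` over `k`, the map
`⟨i, P⟩ ↦ f i ∘ P` is a homeomorphism `(Σ i, X i (L)) ≃ₜ S(L)` for the strong topologies — each `f i` is an open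
immersion, hence an open embedding on `L`-points with image `{Q | Q.pt ∈ f i (X i)}` (SGA1 XII Prop. 3.1 (xi);
the tree's `AlgPoints.isOpenEmbedding_map_holds`, `AlgPoints.range_map_of_isOpenImmersion_holds`), and these
images partition `S(L)`. [cite: SGA1, Exp. XII Prop. 3.1 (xi)] [cite: GortzWedhorn2020, §(3.5) Example 3.11 (p. 73)] -/
theorem exists_sigmaHomeomorph_of_isColimit_cofan (hc : IsColimit (Cofan.mk S f)) :
    ∃ Φ : (Σ i, AlgPoints (X i) L) ≃ₜ AlgPoints S L, ∀ i (P : AlgPoints (X i) L), Φ ⟨i, P⟩ = AlgPoints.map (f i) P := by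
  obtain ⟨hc'⟩ := Morphisms.isColimit_cofan_left hc
  haveI : ∀ i, IsOpenImmersion (f i).left := Morphisms.isOpenImmersion_of_isColimit_cofan hc'
  let φ : (Σ i, AlgPoints (X i) L) → AlgPoints S L := fun p => AlgPoints.map (f p.1) p.2
  have hcont : Continuous φ := continuous_sigma fun i => AlgPoints.continuous_map (f i)
  have hopen : IsOpenMap φ :=
    isOpenMap_sigma.mpr fun i => (AlgPoints.isOpenEmbedding_map_holds (L := L) (f i)).isOpenMap
  have hinj : Injective φ := by
    rintro ⟨i, P⟩ ⟨j, Q⟩ h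
    have hij : i = j := by
      by_contra hij
      have hP : (AlgPoints.map (f i) P).pt ∈ Set.range (f i).left := ⟨P.pt, rfl⟩
      have hQ : (AlgPoints.map (f j) Q).pt ∈ Set.range (f j).left := ⟨Q.pt, rfl⟩
      have h' : (AlgPoints.map (f i) P).pt = (AlgPoints.map (f j) Q).pt := by
        change (φ ⟨i, P⟩).pt = (φ ⟨j, Q⟩).pt; rw [h]
      rw [h'] at hP
      exact Set.disjoint_left.mp (Morphisms.pairwise_disjoint_range_of_isColimit_cofan hc' hij) hP hQ
    subst hij
    have hPQ : P = Q := AlgPoints.map_injective (f i) h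
    subst hPQ
    rfl
  have hsurj : Surjective φ := by
    intro Q
    obtain ⟨i, y, hy⟩ := Morphisms.exists_eq_of_isColimit_cofan hc' Q.pt
    have hQ : Q ∈ Set.range (AlgPoints.map (f i) : AlgPoints (X i) L → AlgPoints S L) := by
      rw [AlgPoints.range_map_of_isOpenImmersion_holds (f i)]
      exact ⟨y, hy⟩
    obtain ⟨P, hP⟩ := hQ
    exact ⟨⟨i, P⟩, hP⟩
  exact ⟨(Equiv.ofBijective φ ⟨hinj, hsurj⟩).toHomeomorphOfContinuousOpen hcont hopen, fun i P => rfl⟩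

end Points

end Literature.AlgebraicGeometry.Motives

end
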